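import Summits.NavierStokesRegularity.NavierStokesRegularity.Theses.AxisymmetricExtremality
import Literature.Analysis.FunctionSpaces.SobolevTracePoincareProofs
import HarnessLib

/-!
# Seregin 2020, Lemma 2.2 (after Nazarov–Uraltseva 2012), piece E2:
# De Giorgi's isoperimetric (level-set) inequality on balls — the general core

Helper toward the stub `stub_seregin2020TypeII` of the crux `AxisymmetricKatoGlobal` (= the named
fact `Literature.Analysis.FluidPDE.Seregin2020_axisymmetricSingularPoint_typeII`, G. Seregin,
Anal. Math. Phys. 10 (2020) Paper 46 = arXiv:2006.04140, Thm 2.1), now reduced to Lemma 2.2 of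
that paper, whose proof is Nazarov–Uraltseva, St. Petersburg Math. J. 23 (2012), §3. The heart of
§3 (Lemma 3.3, "shrinking levels `k_m = 2^{-m} k₀`") is DE GIORGI'S ISOPERIMETRIC INEQUALITY for
level sets of a Sobolev function on a ball (De Giorgi 1957; Caffarelli–Vasseur 2010, Lemma 1.4;
Ladyzhenskaya–Ural'tseva, Ch. II Lemma 3.5): for levels `k < l`,

  `(l - k) · |{w ≤ k} ∩ B_R| · |{w ≥ l} ∩ B_R| ≤ C Rⁿ⁺¹ ∫_{B_R ∩ {k < w < l}} |∇w|`.

This file proves it, in any finite-dimensional real normed space `E` (`n = dim E`) and for any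
additive Haar measure, with the explicit constant `C Rⁿ⁺¹ = 2ⁿ⁺¹ R μ(B_R)`:

* `ofReal_sub_le_setLIntegral_enorm_deriv_of_crossing` — the one-dimensional crossing lemma:
  if `g ∈ C¹[0, 1]`, `g 0 ≤ k < l ≤ g 1`, then `l - k ≤ ∫_{(0,1) ∩ {k < g < l}} |g'|` (last exit
  from `{g ≤ k}`, first subsequent entrance into `{g ≥ l}`, fundamental theorem of calculus in
  between — no chain rule for Lipschitz truncations is needed, and the OPEN band `{k < g < l}`
  comes out directly);
* `deGiorgi_levelSet_ineq_of_ae_segment` — the core two-point argument: `w` is `C¹` on an open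
  set `S`, `A₀ ⊆ B_R ∩ {w ≤ k}` and `A₁ ⊆ B_R ∩ {l ≤ w}` are measurable, and for a.e. pair
  `(x, y) ∈ A₀ × A₁` the segment `[x, y]` lies in `S`; then
  `(l - k) μ(A₀) μ(A₁) ≤ 2ⁿ⁺¹ R μ(B_R) ∫_{S ∩ {k < w < l}} ‖Dw‖` (the crossing lemma along
  `t ↦ x + t(y - x)`, `|d/dt w(x + t(y-x))| ≤ 2R ‖Dw‖`, Tonelli, and the substitution
  `x ↦ (1-t)x + ty` (`t ≤ 1/2`) resp. `y ↦ (1-t)x + ty` (`t ≥ 1/2`) of Jacobian `≥ 2⁻ⁿ`, which is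
  the tree's `Literature.Analysis.FunctionSpaces.lintegral_comp_smul_add_le` from the proof of the
  Poincaré inequality on star-shaped domains, `SobolevTracePoincareProofs`). The a.e.-segment
  form is what the axisymmetric application needs (`w` smooth only off the axis: a.e. segment
  misses a line in `ℝ³`), see the sibling `…Lemma22DeGiorgiIsoperimetricOffAxis`;
* `deGiorgi_isoperimetric_ball` — the classical statement for `w ∈ C¹(B_R)`:
  `(l - k) μ(B_R ∩ {w ≤ k}) μ(B_R ∩ {l ≤ w}) ≤ 2ⁿ⁺¹ R μ(B_R) ∫_{B_R ∩ {k < w < l}} ‖Dw‖`.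

Mathlib has no level-set inequality of this kind (searched `DeGiorgi|isoperimetric|levelSet`);
the tree's two-point estimate `Literature.Analysis.FunctionSpaces.lintegral_prod_enorm_sub_rpow_le_of_contDiff`
(Maz'ya §1.1.10) is the integrated potential estimate for GLOBALLY `C¹` maps, which does not apply
to the (Lipschitz) truncation `min(max(w,k),l)`; the crossing lemma replaces the truncation.

## References

* L. A. Caffarelli, A. F. Vasseur, *The De Giorgi method for regularity of solutions of elliptic
  equations and its applications to fluid dynamics*, DCDS-S 3 (2010) 409–427, Lemma 1.4.
  [CaffarelliVasseur2010DeGiorgiSurvey]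
* A. I. Nazarov, N. N. Uraltseva, St. Petersburg Math. J. 23 (2012) 93–115 = arXiv:1011.1888,
  §3, proof of Lemma 3.3. [NazarovUraltseva2012]
* G. Seregin, Anal. Math. Phys. 10 (2020), Paper 46 = arXiv:2006.04140, Lemma 2.2. [Seregin2020]
-/

-- the problem directory repeats the summit name (D-0017); core's `dupNamespace` linter fires
set_option linter.dupNamespace false

noncomputable section

open MeasureTheory Set Function Filter Topology Metric Module
open scoped NNReal ENNReal

namespace Summit.NavierStokesRegularity.NavierStokesRegularity.Theorems.AxisymmetricKatoGlobal.EulerScaling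

/-! ### The one-dimensional crossing lemma -/

/-- **Crossing lemma.** If `g` is `C¹` on `[0, 1]` (a derivative `g'` at every point of `[0, 1]`,
continuous on `[0, 1]`) and `g 0 ≤ k < l ≤ g 1`, then `l - k ≤ ∫_{(0,1) ∩ {k < g < l}} |g'|`:
with `t₁` the last time `g ≤ k` and `t₂` the first time after `t₁` with `g ≥ l`, the open interval
`(t₁, t₂)` lies in the band `{k < g < l}` and `l - k ≤ g t₂ - g t₁ = ∫_{t₁}^{t₂} g'`. [folklore] -/
theorem ofReal_sub_le_setLIntegral_enorm_deriv_of_crossing {g g' : ℝ → ℝ} {k l : ℝ} (hkl : k < l)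
    (hg : ∀ t ∈ Icc (0 : ℝ) 1, HasDerivAt g (g' t) t) (hg' : ContinuousOn g' (Icc 0 1))
    (h0 : g 0 ≤ k) (h1 : l ≤ g 1) :
    ENNReal.ofReal (l - k) ≤ ∫⁻ t in Ioo (0 : ℝ) 1 ∩ {t | k < g t ∧ g t < l}, ‖g' t‖ₑ := by
  have hgc : ContinuousOn g (Icc 0 1) := fun t ht => (hg t ht).continuousAt.continuousWithinAt
  -- the last time `t₁ ∈ [0, 1]` at which `g ≤ k`
  obtain ⟨t₁, ⟨ht₁I, ht₁k⟩, ht₁max⟩ : ∃ t₁, IsGreatest (Icc (0 : ℝ) 1 ∩ g ⁻¹' Iic k) t₁ :=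
    (isCompact_Icc.of_isClosed_subset
      (hgc.preimage_isClosed_of_isClosed isClosed_Icc isClosed_Iic) inter_subset_left).exists_isGreatest
      ⟨0, ⟨le_rfl, zero_le_one⟩, h0⟩
  -- the first time `t₂ ∈ [t₁, 1]` at which `l ≤ g`
  obtain ⟨t₂, ⟨ht₂I, ht₂l⟩, ht₂min⟩ : ∃ t₂, IsLeast (Icc t₁ 1 ∩ g ⁻¹' Ici l) t₂ :=
    (isCompact_Icc.of_isClosed_subset
      ((hgc.mono (Icc_subset_Icc ht₁I.1 le_rfl)).preimage_isClosed_of_isClosed isClosed_Icc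
        isClosed_Ici) inter_subset_left).exists_isLeast ⟨1, ⟨ht₁I.2, le_rfl⟩, h1⟩
  replace ht₁k : g t₁ ≤ k := ht₁k
  replace ht₂l : l ≤ g t₂ := ht₂l
  have h12 : t₁ < t₂ := lt_of_le_of_ne ht₂I.1 fun h => by
    rw [h] at ht₁k
    linarith
  -- on `(t₁, t₂)` the values lie strictly between the levels
  have hband : Ioo t₁ t₂ ⊆ Ioo (0 : ℝ) 1 ∩ {t | k < g t ∧ g t < l} := by
    intro t ht
    have htI : t ∈ Icc (0 : ℝ) 1 := ⟨ht₁I.1.trans ht.1.le, ht.2.le.trans ht₂I.2⟩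
    refine ⟨⟨ht₁I.1.trans_lt ht.1, ht.2.trans_le ht₂I.2⟩, ?_, ?_⟩
    · by_contra hle
      exact (not_le.2 ht.1) (ht₁max ⟨htI, (not_lt.1 hle : g t ≤ k)⟩)
    · by_contra hle
      exact (not_le.2 ht.2) (ht₂min ⟨⟨ht.1.le, htI.2⟩, (not_lt.1 hle : l ≤ g t)⟩)
  -- the fundamental theorem of calculus on `[t₁, t₂]`
  have hsub : Icc t₁ t₂ ⊆ Icc 0 1 := Icc_subset_Icc ht₁I.1 ht₂I.2
  have hftc : ∫ t in t₁..t₂, g' t = g t₂ - g t₁ :=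
    intervalIntegral.integral_eq_sub_of_hasDerivAt_of_le h12.le (hgc.mono hsub)
      (fun t ht => hg t (hsub (Ioo_subset_Icc_self ht)))
      ((hg'.mono hsub).intervalIntegrable_of_Icc h12.le)
  calc ENNReal.ofReal (l - k) ≤ ENNReal.ofReal (∫ t in t₁..t₂, g' t) :=
        ENNReal.ofReal_le_ofReal (by rw [hftc]; linarith)
    _ ≤ ‖∫ t in t₁..t₂, g' t‖ₑ := Real.ofReal_le_enorm _
    _ = ‖∫ t in Ioc t₁ t₂, g' t‖ₑ := by rw [intervalIntegral.integral_of_le h12.le]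
    _ ≤ ∫⁻ t in Ioc t₁ t₂, ‖g' t‖ₑ := enorm_integral_le_lintegral_enorm _
    _ = ∫⁻ t in Ioo t₁ t₂, ‖g' t‖ₑ := setLIntegral_congr Ioo_ae_eq_Ioc.symm
    _ ≤ ∫⁻ t in Ioo (0 : ℝ) 1 ∩ {t | k < g t ∧ g t < l}, ‖g' t‖ₑ := lintegral_mono_set hband

/-! ### The core two-point estimate -/

variable {E : Type*} [NormedAddCommGroup E] [NormedSpace ℝ E] [FiniteDimensional ℝ E]
  [MeasurableSpace E] [BorelSpace E]

omit [NormedSpace ℝ E] [FiniteDimensional ℝ E] [MeasurableSpace E] [BorelSpace E] in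
/-- Two points of `B(x₀, R)` are at distance at most `2R` (in `ℝ≥0∞`). [folklore] -/
theorem enorm_sub_le_two_mul_ofReal_of_mem_ball {x₀ x y : E} {R : ℝ} (hx : x ∈ ball x₀ R)
    (hy : y ∈ ball x₀ R) : ‖y - x‖ₑ ≤ 2 * ENNReal.ofReal R := by
  rw [← ofReal_norm, ← ENNReal.ofReal_ofNat, ← ENNReal.ofReal_mul zero_le_two]
  refine ENNReal.ofReal_le_ofReal ?_
  rw [← dist_eq_norm]
  rw [mem_ball] at hx hy
  linarith [dist_triangle_right y x x₀]

/-- For an open `U` and `f` continuous on `U`, the sublevel set `U ∩ {f ≤ k}` is measurable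
(its complement in `U` is open). [folklore] -/
theorem measurableSet_inter_setOf_le_of_continuousOn {X : Type*} [TopologicalSpace X]
    [MeasurableSpace X] [OpensMeasurableSpace X] {U : Set X} (hU : IsOpen U) {f : X → ℝ}
    (hf : ContinuousOn f U) (k : ℝ) : MeasurableSet (U ∩ {x | f x ≤ k}) := by
  have h : U ∩ {x | f x ≤ k} = U \ (U ∩ f ⁻¹' Ioi k) := by
    ext x
    simp only [mem_inter_iff, mem_setOf_eq, Set.mem_sdiff, mem_preimage, mem_Ioi, not_and, not_lt]
    tauto
  rw [h]
  exact hU.measurableSet.diff (hf.isOpen_inter_preimage hU isOpen_Ioi).measurableSet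

/-- For an open `U` and `f` continuous on `U`, the superlevel set `U ∩ {k ≤ f}` is measurable.
[folklore] -/
theorem measurableSet_inter_setOf_ge_of_continuousOn {X : Type*} [TopologicalSpace X]
    [MeasurableSpace X] [OpensMeasurableSpace X] {U : Set X} (hU : IsOpen U) {f : X → ℝ}
    (hf : ContinuousOn f U) (k : ℝ) : MeasurableSet (U ∩ {x | k ≤ f x}) := by
  have h : U ∩ {x | k ≤ f x} = U \ (U ∩ f ⁻¹' Iio k) := by
    ext x
    simp only [mem_inter_iff, mem_setOf_eq, Set.mem_sdiff, mem_preimage, mem_Iio, not_and, not_lt]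
    tauto
  rw [h]
  exact hU.measurableSet.diff (hf.isOpen_inter_preimage hU isOpen_Iio).measurableSet

/-- **De Giorgi's level-set inequality, core form with an a.e.-segment hypothesis.** Let `μ` be an
additive Haar measure on the `n`-dimensional real normed space `E`, `S` open, `w ∈ C¹(S)`,
`k < l`, and `A₀ ⊆ B(x₀, R) ∩ {w ≤ k}`, `A₁ ⊆ B(x₀, R) ∩ {l ≤ w}` measurable sets such
that for `μ ⊗ μ`-a.e. `(x, y) ∈ A₀ × A₁` the segment `[x, y]` lies in `S`. Then
`(l - k) μ(A₀) μ(A₁) ≤ 2ⁿ⁺¹ R μ(B(x₀, R)) ∫_{S ∩ {k < w < l}} ‖Dw‖ dμ`.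
Proof: for such a pair, the crossing lemma applied to `t ↦ w(x + t(y - x))`, whose derivative is
bounded by `‖y - x‖ ‖Dw‖ ≤ 2R ‖Dw‖`, gives `l - k ≤ 2R ∫₀¹ H(x + t(y - x)) dt` with
`H = 𝟙_{S ∩ {k<w<l}} ‖Dw‖`; integrating over `A₀ × A₁`, exchanging the integrals (Tonelli) and
substituting `x ↦ (1-t)x + ty` for `t ≤ 1/2`, `y ↦ (1-t)x + ty` for `t ≥ 1/2` (Jacobian `≥ 2⁻ⁿ`,
`Literature.Analysis.FunctionSpaces.lintegral_comp_smul_add_le`) bounds the right-hand side by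
`2R · 2ⁿ μ(B) ∫ H`. [cite: CaffarelliVasseur2010DeGiorgiSurvey, Lemma 1.4, proof] -/
theorem deGiorgi_levelSet_ineq_of_ae_segment (μ : Measure E) [μ.IsAddHaarMeasure] {w : E → ℝ}
    {S : Set E} (hS : IsOpen S) (hw : ContDiffOn ℝ 1 w S) {x₀ : E} {R : ℝ} {k l : ℝ} (hkl : k < l) {A₀ A₁ : Set E} (hA₀m : MeasurableSet A₀) (hA₁m : MeasurableSet A₁)
    (hA₀ : A₀ ⊆ ball x₀ R ∩ {x | w x ≤ k}) (hA₁ : A₁ ⊆ ball x₀ R ∩ {x | l ≤ w x})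
    (hseg : ∀ᵐ z ∂(μ.restrict A₀).prod (μ.restrict A₁), z ∈ A₀ ×ˢ A₁ → segment ℝ z.1 z.2 ⊆ S) :
    ENNReal.ofReal (l - k) * μ A₀ * μ A₁ ≤
      2 ^ (finrank ℝ E + 1) * ENNReal.ofReal R * μ (ball x₀ R) *
        ∫⁻ x in S ∩ {x | k < w x ∧ w x < l}, ‖fderiv ℝ w x‖ₑ ∂μ := by
  set n := finrank ℝ E with hn
  -- the integrand `H = 𝟙_{S ∩ {k < w < l}} ‖Dw‖`
  have hS'o : IsOpen (S ∩ w ⁻¹' Ioo k l) := hw.continuousOn.isOpen_inter_preimage hS isOpen_Ioo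
  set H : E → ℝ≥0∞ := (S ∩ w ⁻¹' Ioo k l).indicator fun x => ‖fderiv ℝ w x‖ₑ with hH
  have hHm : Measurable H := (measurable_fderiv ℝ w).enorm.indicator hS'o.measurableSet
  have hHint : ∫⁻ x, H x ∂μ = ∫⁻ x in S ∩ {x | k < w x ∧ w x < l}, ‖fderiv ℝ w x‖ₑ ∂μ :=
    lintegral_indicator hS'o.measurableSet _
  have hDw : ContinuousOn (fderiv ℝ w) S := hw.continuousOn_fderiv_of_isOpen hS le_rfl
  have hdiff : ∀ p ∈ S, HasFDerivAt w (fderiv ℝ w p) p := fun p hp =>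
    ((hw.differentiableOn one_ne_zero).differentiableAt (hS.mem_nhds hp)).hasFDerivAt
  -- Step 1: the pointwise estimate along a segment inside `S`
  have step1 : ∀ x ∈ A₀, ∀ y ∈ A₁, segment ℝ x y ⊆ S →
      ENNReal.ofReal (l - k) ≤
        2 * ENNReal.ofReal R * ∫⁻ t in Ioo (0 : ℝ) 1, H (x + t • (y - x)) := by
    intro x hx y hy hxy
    set γ : ℝ → E := fun t => x + t • (y - x) with hγ
    have hγc : Continuous γ := by fun_prop
    have hγS : ∀ t ∈ Icc (0 : ℝ) 1, γ t ∈ S := fun t ht =>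
      hxy (by rw [segment_eq_image']; exact mem_image_of_mem _ ht)
    have hγd : ∀ t, HasDerivAt γ (y - x) t := fun t => by
      have h := ((hasDerivAt_id' t).smul_const (y - x)).const_add x
      rwa [one_smul] at h
    set g : ℝ → ℝ := fun t => w (γ t) with hg
    set g' : ℝ → ℝ := fun t => fderiv ℝ w (γ t) (y - x) with hg'
    have hgd : ∀ t ∈ Icc (0 : ℝ) 1, HasDerivAt g (g' t) t := fun t ht =>
      (hdiff _ (hγS t ht)).comp_hasDerivAt t (hγd t)
    have hg'c : ContinuousOn g' (Icc 0 1) :=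
      (hDw.comp hγc.continuousOn hγS).clm_apply continuousOn_const
    have h0 : g 0 ≤ k := by simpa [hg, hγ] using (hA₀ hx).2
    have h1 : l ≤ g 1 := by simpa [hg, hγ] using (hA₁ hy).2
    have h2R : ‖y - x‖ₑ ≤ 2 * ENNReal.ofReal R :=
      enorm_sub_le_two_mul_ofReal_of_mem_ball (hA₀ hx).1 (hA₁ hy).1
    calc ENNReal.ofReal (l - k)
        ≤ ∫⁻ t in Ioo (0 : ℝ) 1 ∩ {t | k < g t ∧ g t < l}, ‖g' t‖ₑ :=
          ofReal_sub_le_setLIntegral_enorm_deriv_of_crossing hkl hgd hg'c h0 h1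
      _ ≤ ∫⁻ t in Ioo (0 : ℝ) 1 ∩ {t | k < g t ∧ g t < l}, 2 * ENNReal.ofReal R * H (γ t) := by
          refine setLIntegral_mono ((hHm.comp hγc.measurable).const_mul _) fun t ht => ?_
          have htS' : γ t ∈ S ∩ w ⁻¹' Ioo k l := ⟨hγS t (Ioo_subset_Icc_self ht.1), ht.2⟩
          simp only [hH, indicator_of_mem htS', hg']
          calc ‖fderiv ℝ w (γ t) (y - x)‖ₑ ≤ ‖fderiv ℝ w (γ t)‖ₑ * ‖y - x‖ₑ :=
                ContinuousLinearMap.le_opENorm _ _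
            _ ≤ ‖fderiv ℝ w (γ t)‖ₑ * (2 * ENNReal.ofReal R) := by gcongr
            _ = 2 * ENNReal.ofReal R * ‖fderiv ℝ w (γ t)‖ₑ := mul_comm _ _
      _ ≤ ∫⁻ t in Ioo (0 : ℝ) 1, 2 * ENNReal.ofReal R * H (γ t) :=
          lintegral_mono_set inter_subset_left
      _ = 2 * ENNReal.ofReal R * ∫⁻ t in Ioo (0 : ℝ) 1, H (x + t • (y - x)) :=
          lintegral_const_mul _ (hHm.comp hγc.measurable)
  -- the transported integrand on `(E × E) × ℝ`
  set Φ : (E × E) × ℝ → ℝ≥0∞ := fun q => H (q.1.1 + q.2 • (q.1.2 - q.1.1)) with hΦ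
  have hΦm : Measurable Φ := by
    refine hHm.comp ?_
    exact (measurable_fst.comp measurable_fst).add
      (measurable_snd.smul ((measurable_snd.comp measurable_fst).sub
        (measurable_fst.comp measurable_fst)))
  set ν := (μ.restrict A₀).prod (μ.restrict A₁) with hν
  have hA₀B : μ A₀ ≤ μ (ball x₀ R) := measure_mono fun x hx => (hA₀ hx).1
  have hA₁B : μ A₁ ≤ μ (ball x₀ R) := measure_mono fun x hx => (hA₁ hx).1
  -- Step 2: for fixed `t`, the integral over the pairs is at most `2ⁿ μ(B) ∫ H`
  have step2 : ∀ t ∈ Ioo (0 : ℝ) 1, ∫⁻ z, Φ (z, t) ∂ν ≤ 2 ^ n * μ (ball x₀ R) * ∫⁻ x, H x ∂μ := by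
    intro t ht
    have hΦt : Measurable fun z : E × E => Φ (z, t) :=
      hΦm.comp (measurable_id.prodMk measurable_const)
    rcases le_or_gt t (1 / 2) with ht2 | ht2
    · -- `t ≤ 1/2`: integrate first in `x`; `x ↦ (1 - t) x + t y` has Jacobian `≥ 2⁻ⁿ`
      calc ∫⁻ z, Φ (z, t) ∂ν = ∫⁻ y in A₁, ∫⁻ x in A₀, Φ ((x, y), t) ∂μ ∂μ :=
            lintegral_prod_symm _ hΦt.aemeasurable
        _ ≤ ∫⁻ y in A₁, ∫⁻ x, Φ ((x, y), t) ∂μ ∂μ :=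
            lintegral_mono fun y => lintegral_mono' Measure.restrict_le_self le_rfl
        _ = ∫⁻ y in A₁, ∫⁻ x, H ((1 - t) • x + t • y) ∂μ ∂μ := by
            congr 1 with y; congr 1 with x
            simp only [hΦ]
            congr 1
            module
        _ ≤ ∫⁻ y in A₁, 2 ^ n * ∫⁻ x, H x ∂μ ∂μ := by
            refine lintegral_mono fun y => ?_
            exact Literature.Analysis.FunctionSpaces.lintegral_comp_smul_add_le μ hHm
              (by linarith) _
        _ = 2 ^ n * μ A₁ * ∫⁻ x, H x ∂μ := by
            rw [lintegral_const, Measure.restrict_apply_univ]; ring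
        _ ≤ 2 ^ n * μ (ball x₀ R) * ∫⁻ x, H x ∂μ := by gcongr
    · -- `t > 1/2`: integrate first in `y`; `y ↦ (1 - t) x + t y` has Jacobian `≥ 2⁻ⁿ`
      calc ∫⁻ z, Φ (z, t) ∂ν = ∫⁻ x in A₀, ∫⁻ y in A₁, Φ ((x, y), t) ∂μ ∂μ :=
            lintegral_prod _ hΦt.aemeasurable
        _ ≤ ∫⁻ x in A₀, ∫⁻ y, Φ ((x, y), t) ∂μ ∂μ :=
            lintegral_mono fun x => lintegral_mono' Measure.restrict_le_self le_rfl
        _ = ∫⁻ x in A₀, ∫⁻ y, H (t • y + (1 - t) • x) ∂μ ∂μ := by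
            congr 1 with x; congr 1 with y
            simp only [hΦ]
            congr 1
            module
        _ ≤ ∫⁻ x in A₀, 2 ^ n * ∫⁻ x, H x ∂μ ∂μ := by
            refine lintegral_mono fun x => ?_
            exact Literature.Analysis.FunctionSpaces.lintegral_comp_smul_add_le μ hHm ht2.le _
        _ = 2 ^ n * μ A₀ * ∫⁻ x, H x ∂μ := by
            rw [lintegral_const, Measure.restrict_apply_univ]; ring
        _ ≤ 2 ^ n * μ (ball x₀ R) * ∫⁻ x, H x ∂μ := by gcongr
  -- Step 3: integrate Step 1 over `A₀ × A₁`, exchange the integrals, use Step 2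
  have hνu : ν univ = μ A₀ * μ A₁ := by
    rw [hν, ← univ_prod_univ, Measure.prod_prod, Measure.restrict_apply_univ,
      Measure.restrict_apply_univ]
  have hmem : ∀ᵐ z ∂ν, z ∈ A₀ ×ˢ A₁ := by
    rw [hν, Measure.prod_restrict]
    exact ae_restrict_mem (hA₀m.prod hA₁m)
  have hae : ∀ᵐ z ∂ν, ENNReal.ofReal (l - k) ≤
      2 * ENNReal.ofReal R * ∫⁻ t in Ioo (0 : ℝ) 1, Φ (z, t) := by
    filter_upwards [hmem, hseg] with z hz hzS
    exact step1 z.1 hz.1 z.2 hz.2 (hzS hz)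
  have h2R : 2 * ENNReal.ofReal R ≠ ∞ := ENNReal.mul_ne_top ENNReal.ofNat_ne_top ENNReal.ofReal_ne_top
  calc ENNReal.ofReal (l - k) * μ A₀ * μ A₁ = ∫⁻ _, ENNReal.ofReal (l - k) ∂ν := by
        rw [lintegral_const, hνu, mul_assoc]
    _ ≤ ∫⁻ z, 2 * ENNReal.ofReal R * (∫⁻ t in Ioo (0 : ℝ) 1, Φ (z, t)) ∂ν := lintegral_mono_ae hae
    _ = 2 * ENNReal.ofReal R * ∫⁻ z, (∫⁻ t in Ioo (0 : ℝ) 1, Φ (z, t)) ∂ν :=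
        lintegral_const_mul' _ _ h2R
    _ = 2 * ENNReal.ofReal R * ∫⁻ t in Ioo (0 : ℝ) 1, ∫⁻ z, Φ (z, t) ∂ν := by
        rw [lintegral_lintegral_swap hΦm.aemeasurable]
    _ ≤ 2 * ENNReal.ofReal R * ∫⁻ _ in Ioo (0 : ℝ) 1, 2 ^ n * μ (ball x₀ R) * ∫⁻ x, H x ∂μ := by
        gcongr 1
        exact setLIntegral_mono' measurableSet_Ioo fun t ht => step2 t ht
    _ = 2 ^ (n + 1) * ENNReal.ofReal R * μ (ball x₀ R) *
          ∫⁻ x in S ∩ {x | k < w x ∧ w x < l}, ‖fderiv ℝ w x‖ₑ ∂μ := by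
        rw [lintegral_const, Measure.restrict_apply_univ, Real.volume_Ioo, sub_zero,
          ENNReal.ofReal_one, mul_one, hHint]
        ring

/-! ### The classical statement for `C¹` functions on the ball -/

/-- **De Giorgi's isoperimetric inequality on a ball** (De Giorgi 1957; Caffarelli–Vasseur 2010,
Lemma 1.4; the `L¹`-gradient form used by Nazarov–Uraltseva 2012 in the proof of Lemma 3.3). For
`w ∈ C¹(B(x₀, R))` on an `n`-dimensional real normed space with an additive Haar measure `μ` and
levels `k < l`:
`(l - k) · μ(B ∩ {w ≤ k}) · μ(B ∩ {l ≤ w}) ≤ 2ⁿ⁺¹ R μ(B) ∫_{B ∩ {k < w < l}} ‖Dw‖ dμ`,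
`B = B(x₀, R)` (so `C Rⁿ⁺¹` with `C = 2ⁿ⁺¹ μ(B(0,1))`). The band on the right is the OPEN one
`{k < w < l}`. [cite: CaffarelliVasseur2010DeGiorgiSurvey, Lemma 1.4] -/
theorem deGiorgi_isoperimetric_ball (μ : Measure E) [μ.IsAddHaarMeasure] {w : E → ℝ} {x₀ : E}
    {R : ℝ} (hw : ContDiffOn ℝ 1 w (ball x₀ R)) {k l : ℝ} (hkl : k < l) :
    ENNReal.ofReal (l - k) * μ (ball x₀ R ∩ {x | w x ≤ k}) * μ (ball x₀ R ∩ {x | l ≤ w x}) ≤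
      2 ^ (finrank ℝ E + 1) * ENNReal.ofReal R * μ (ball x₀ R) *
        ∫⁻ x in ball x₀ R ∩ {x | k < w x ∧ w x < l}, ‖fderiv ℝ w x‖ₑ ∂μ :=
  deGiorgi_levelSet_ineq_of_ae_segment μ isOpen_ball hw hkl
    (measurableSet_inter_setOf_le_of_continuousOn isOpen_ball hw.continuousOn k)
    (measurableSet_inter_setOf_ge_of_continuousOn isOpen_ball hw.continuousOn l)
    Subset.rfl Subset.rfl
    (ae_of_all _ fun _ hz => (convex_ball x₀ R).segment_subset hz.1.1 hz.2.1)

/-! ### The statement in `ℝ³` with an explicit constant -/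

/-- For `0 < R`: `2⁴ R · |B(x₀, R)| = (64π/3) R⁴` in `ℝ³` (`|B_R| = (4π/3) R³`). [folklore] -/
theorem ofReal_deGiorgiConst_fin_three {R : ℝ} (hR : 0 ≤ R) (x₀ : EuclideanSpace ℝ (Fin 3)) :
    ENNReal.ofReal (64 * Real.pi / 3 * R ^ 4) =
      2 ^ (3 + 1) * ENNReal.ofReal R * volume (ball x₀ R) := by
  have h : (64 * Real.pi / 3 * R ^ 4 : ℝ) = 2 ^ (3 + 1) * R * (R ^ 3 * (Real.pi * 4 / 3)) := by
    ring
  have h1 : (0 : ℝ) ≤ 2 ^ (3 + 1) * R := by positivity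
  have h2 : (0 : ℝ) ≤ 2 ^ (3 + 1) := by positivity
  have h3 : (0 : ℝ) ≤ R ^ 3 := by positivity
  rw [EuclideanSpace.volume_ball_fin_three, h, ENNReal.ofReal_mul h1, ENNReal.ofReal_mul h2,
    ENNReal.ofReal_mul h3, ENNReal.ofReal_pow hR, ENNReal.ofReal_pow zero_le_two,
    ENNReal.ofReal_ofNat]

/-- **De Giorgi's isoperimetric inequality on balls of `ℝ³`, explicit constant.** For
`w ∈ C¹(B(x₀, R))`, `B(x₀, R) ⊆ ℝ³` the open ball, and levels `k < l`:
`(l - k) · |B ∩ {w ≤ k}| · |B ∩ {l ≤ w}| ≤ (64π/3) R⁴ ∫_{B ∩ {k < w < l}} ‖Dw‖`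
(`2ⁿ⁺¹ R |B_R|` with `n = 3`, `|B_R| = (4π/3)R³`). This is the inequality used slice-wise in
Nazarov–Uraltseva 2012, proof of Lemma 3.3 (piece E2 of the Lemma-2.2 frontier of Seregin 2020).
[cite: CaffarelliVasseur2010DeGiorgiSurvey, Lemma 1.4] -/
theorem deGiorgi_isoperimetric_ball_fin_three :
    ∀ (w : EuclideanSpace ℝ (Fin 3) → ℝ) (x₀ : EuclideanSpace ℝ (Fin 3)) (R k l : ℝ),
      ContDiffOn ℝ 1 w (ball x₀ R) → k < l →
      ENNReal.ofReal (l - k) * volume (ball x₀ R ∩ {x | w x ≤ k}) *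
          volume (ball x₀ R ∩ {x | l ≤ w x}) ≤
        ENNReal.ofReal (64 * Real.pi / 3 * R ^ 4) *
          ∫⁻ x in ball x₀ R ∩ {x | k < w x ∧ w x < l}, ‖fderiv ℝ w x‖ₑ := by
  intro w x₀ R k l hw hkl
  rcases le_or_gt R 0 with hR | hR
  · simp [Metric.ball_eq_empty.2 hR]
  calc _ ≤ _ := deGiorgi_isoperimetric_ball volume hw hkl
    _ = _ := by rw [finrank_euclideanSpace_fin, ofReal_deGiorgiConst_fin_three hR.le x₀]

end Summit.NavierStokesRegularity.NavierStokesRegularity.Theorems.AxisymmetricKatoGlobal.EulerScaling
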